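import Summits.Schanuel.Schanuel.Theorems.DiophantineDichotomyDefs
import Literature.NumberTheory.Transcendental.QuadraticRelationsLogarithmsMahlerWeil
import Literature.NumberTheory.DiophantineApproximation.ApproximationByAlgebraicNumbersProofs

/-!
# Lemmas for `stub_transferOfSiegel` (line `lw-small-height`, crux stmt-Schanuel-6116)

Route `DiophantineDichotomy`, crux `KhovanskiiApproxType`, registered stub
`stub_transferOfSiegel : SiegelInIdeal → CodimOneTransfer` (objects of
`Summits.Schanuel.Schanuel.Theorems.DiophantineDichotomyDefs`; the stub itself is proved in
`DiophantineDichotomyKhovanskiiApproxTypeTransferOfSiegel.lean`, which imports this file).  Here, in the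
sub-namespace `TransferOfSiegel`, the two algebraic inputs of the transfer, repackaged at the end as the
registered sub-goal `stub_transferOfSiegel_lemmas` (`--supports stmt-Schanuel-6116`):

* HEIGHTS OF THE SLOTS: a complex root `z` of a non-zero `P ∈ ℤ[X]` of degree `≤ d` and naive height
  `≤ H`, of degree `≥ d'` over `ℚ`, has absolute logarithmic Weil height `h(z) ≤ (log H + d)/d'`
  (`weilHeight₁_slot_le`: an irreducible factor `f ∣ P` vanishes at `z`, `deg f = deg minpoly_ℚ z ≥ d'`
  by Gauss's lemma, `h(z) ≤ log M(f)/deg f` (tree lemma `MahlerWeil.weilHeight₁_root_le`),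
  `M(f) ≤ M(P) ≤ √(d+1)·H` (Landau));
* THE AUXILIARY POLYNOMIAL ON A BOX: for `Q ∈ ℤ[X₁,…,X_m]` supported on `[0,t]^m`, `deg Q ≤ m t`,
  `#supp Q ≤ (t+1)^m`, `|coeff| ≤ H(Q)`, and the mean value bound
  `|Q(a) − Q(b)| ≤ #supp Q · H(Q) · m t · R^{m t} · ‖a − b‖` for `‖a‖, ‖b‖ ≤ R`, `R ≥ 1` (sup norm),
  proved from `|∏ xᵢ − ∏ yᵢ| ≤ (Σ nᵢ) R^{Σ nᵢ} ε` by induction.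
-/

noncomputable section

-- `Summit.Schanuel.Schanuel.…` is the mandated summit/sub-problem namespace (single-conjunct summit), hence:
set_option linter.dupNamespace false

namespace Summit.Schanuel.Schanuel.Cruxes.KhovanskiiApproxType.LwSmallHeight

open Literature.NumberTheory.Transcendental (weilHeight₁)
open Polynomial

namespace TransferOfSiegel

/-! ## Slots: irreducible factors, minimal polynomials, Mahler measures, Weil heights -/

/-- A non-zero integer polynomial vanishing at `z ∈ ℂ` has an irreducible factor of positive degree
vanishing at `z`. -/
theorem exists_irreducible_factor_aeval_eq_zero (z : ℂ) (P : ℤ[X]) :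
    P ≠ 0 → aeval z P = 0 → ∃ f : ℤ[X], Irreducible f ∧ f ∣ P ∧ 0 < f.natDegree ∧ aeval z f = 0 := by
  induction P using WfDvdMonoid.induction_on_irreducible with
  | zero => intro h; exact absurd rfl h
  | unit u hu =>
    intro _ hz
    exfalso
    obtain ⟨r, hr, rfl⟩ := Polynomial.isUnit_iff.1 hu
    rw [aeval_C, algebraMap_int_eq, eq_intCast, Int.cast_eq_zero] at hz
    exact hr.ne_zero hz
  | mul a i ha hi ih =>
    intro _ hz
    rw [map_mul, mul_eq_zero] at hz
    rcases hz with hzi | hza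
    · refine ⟨i, hi, dvd_mul_right i a, ?_, hzi⟩
      exact natDegree_pos_of_aeval_root hi.ne_zero hzi fun x hx => by
        rwa [algebraMap_int_eq, eq_intCast, Int.cast_eq_zero] at hx
    · obtain ⟨f, hf, hfa, hdeg, hfz⟩ := ih ha hza
      exact ⟨f, hf, hfa.trans (dvd_mul_left a i), hdeg, hfz⟩

/-- The degree of the minimal polynomial over `ℚ` of a root of an irreducible integer polynomial of
positive degree is the degree of that polynomial (Gauss's lemma). -/
theorem natDegree_minpoly_eq_of_irreducible (z : ℂ) (f : ℤ[X]) (hf : Irreducible f)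
    (hdeg : 0 < f.natDegree) (hz : aeval z f = 0) : (minpoly ℚ z).natDegree = f.natDegree := by
  have hprim : f.IsPrimitive := hf.isPrimitive hdeg.ne'
  have hirrQ : Irreducible (f.map (Int.castRingHom ℚ)) :=
    (IsPrimitive.Int.irreducible_iff_irreducible_map_cast hprim).1 hf
  have hzQ : aeval z (f.map (Int.castRingHom ℚ)) = 0 := by
    rw [← algebraMap_int_eq, aeval_map_algebraMap]; exact hz
  have key := minpoly.eq_of_irreducible hirrQ hzQ
  rw [← key, natDegree_mul_C, natDegree_map_eq_of_injective (Int.castRingHom ℚ).injective_int]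
  exact inv_ne_zero (leadingCoeff_ne_zero.2 hirrQ.ne_zero)

/-- Landau's inequality for an integer polynomial of naive height `≤ H`:
`M(P) ≤ √(deg P + 1) · H`. -/
theorem mahlerMeasure_map_le_of_coeff_le (P : ℤ[X]) (H : ℕ) (hH : ∀ k, |P.coeff k| ≤ (H : ℤ)) :
    (P.map (Int.castRingHom ℂ)).mahlerMeasure ≤ Real.sqrt (P.natDegree + 1) * H := by
  set p := P.map (Int.castRingHom ℂ) with hp
  have hsup : p.supNorm ≤ H := by
    obtain ⟨i, hi⟩ := p.exists_eq_supNorm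
    rw [hi, hp, coeff_map, eq_intCast, Complex.norm_intCast]
    exact_mod_cast hH i
  have hdeg : (p.natDegree : ℝ) ≤ P.natDegree := by exact_mod_cast natDegree_map_le
  have hs0 := p.supNorm_nonneg
  calc p.mahlerMeasure ≤ Real.sqrt (p.natDegree + 1) * p.supNorm :=
        mahlerMeasure_le_sqrt_natDegree_add_one_mul_supNorm p
    _ ≤ Real.sqrt (P.natDegree + 1) * H := by gcongr

/-- `1 ≤ H` as soon as a non-zero integer polynomial has all its coefficients bounded by `H`. -/
theorem one_le_of_coeff_le (P : ℤ[X]) (hP : P ≠ 0) (H : ℕ) (hH : ∀ k, |P.coeff k| ≤ (H : ℤ)) :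
    1 ≤ H := by
  have h1 : (1 : ℤ) ≤ |P.leadingCoeff| := Int.one_le_abs (leadingCoeff_ne_zero.2 hP)
  have h2 := hH P.natDegree
  rw [coeff_natDegree] at h2
  exact_mod_cast h1.trans h2

/-- HEIGHT OF A SLOT: if `z ∈ F` has degree `≥ d'` over `ℚ` and is a root of a non-zero integer
polynomial of degree `≤ d` and naive height `≤ H`, then `h(z) ≤ (log H + d)/d'`
(`h(z) = log M(f)/deg f` for the irreducible factor `f` vanishing at `z`, `M(f) ≤ M(P) ≤ √(d+1) H`). -/
theorem weilHeight₁_slot_le (F : IntermediateField ℚ ℂ) [FiniteDimensional ℚ F] {z : ℂ} (hzF : z ∈ F)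
    (d d' H : ℕ) (hd' : 1 ≤ d') (hmin : d' ≤ (minpoly ℚ z).natDegree)
    (P : ℤ[X]) (hP0 : P ≠ 0) (hPdeg : P.natDegree ≤ d) (hPH : ∀ k, |P.coeff k| ≤ (H : ℤ))
    (hPz : aeval z P = 0) :
    weilHeight₁ F (fun _ : Unit => z) ≤ (Real.log H + d) / d' := by
  obtain ⟨f, hf, hfP, hfdeg, hfz⟩ := exists_irreducible_factor_aeval_eq_zero z P hP0 hPz
  have hH1 : 1 ≤ H := one_le_of_coeff_le P hP0 H hPH
  have hroot := Literature.NumberTheory.Transcendental.RoyWaldschmidt1997.MahlerWeil.weilHeight₁_root_le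
    f hf hfdeg hfz F hzF
  refine hroot.trans ?_
  have hMf1 : 1 ≤ (f.map (Int.castRingHom ℂ)).mahlerMeasure :=
    Literature.NumberTheory.DiophantineApproximation.one_le_mahlerMeasure_map f hf.ne_zero
  have hMfP : (f.map (Int.castRingHom ℂ)).mahlerMeasure ≤ (P.map (Int.castRingHom ℂ)).mahlerMeasure :=
    Literature.NumberTheory.DiophantineApproximation.mahlerMeasure_map_le_of_dvd hfP hP0
  have hMP : (P.map (Int.castRingHom ℂ)).mahlerMeasure ≤ Real.sqrt (P.natDegree + 1) * H :=
    mahlerMeasure_map_le_of_coeff_le P H hPH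
  have hH0 : (0 : ℝ) < H := by exact_mod_cast hH1
  have hsq0 : 0 < Real.sqrt (P.natDegree + 1) := Real.sqrt_pos.2 (by positivity)
  have hlog : Real.log (f.map (Int.castRingHom ℂ)).mahlerMeasure ≤ Real.log H + d := by
    have h1 : Real.log (f.map (Int.castRingHom ℂ)).mahlerMeasure ≤
        Real.log (Real.sqrt (P.natDegree + 1) * H) :=
      Real.log_le_log (by linarith) (hMfP.trans hMP)
    rw [Real.log_mul hsq0.ne' hH0.ne', Real.log_sqrt (by positivity)] at h1
    have h2 : Real.log ((P.natDegree : ℝ) + 1) ≤ (P.natDegree : ℝ) + 1 - 1 :=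
      Real.log_le_sub_one_of_pos (by positivity)
    have h3 : (P.natDegree : ℝ) ≤ d := by exact_mod_cast hPdeg
    have h4 : 0 ≤ Real.log ((P.natDegree : ℝ) + 1) := Real.log_nonneg (by linarith)
    linarith
  have hlog0 : 0 ≤ Real.log (f.map (Int.castRingHom ℂ)).mahlerMeasure := Real.log_nonneg hMf1
  have hdegf : (d' : ℝ) ≤ f.natDegree := by
    rw [← natDegree_minpoly_eq_of_irreducible z f hf hfdeg hfz]; exact_mod_cast hmin
  have hd'0 : (0 : ℝ) < d' := by exact_mod_cast hd'
  have hLd : 0 ≤ Real.log H + d := add_nonneg (Real.log_nonneg (by exact_mod_cast hH1)) (by positivity)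
  exact div_le_div₀ hLd hlog hd'0 hdegf


/-! ## The auxiliary polynomial: box support, total degree, naive height, mean value bound -/

/-- A polynomial supported on the box `[0,t]^m` has total degree `≤ m t`. -/
theorem totalDegree_le_of_box {m t : ℕ} (Q : MvPolynomial (Fin m) ℤ)
    (hbox : ∀ e ∈ Q.support, ∀ i, e i ≤ t) : Q.totalDegree ≤ m * t := by
  rw [MvPolynomial.totalDegree]
  refine Finset.sup_le fun e he => ?_
  rw [Finsupp.sum_fintype _ _ (fun _ => rfl)]
  calc ∑ i, e i ≤ ∑ _i : Fin m, t := Finset.sum_le_sum fun i _ => hbox e he i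
    _ = m * t := by simp

/-- A polynomial supported on the box `[0,t]^m` has at most `(t+1)^m` monomials. -/
theorem card_support_le_of_box {m t : ℕ} (Q : MvPolynomial (Fin m) ℤ)
    (hbox : ∀ e ∈ Q.support, ∀ i, e i ≤ t) : Q.support.card ≤ (t + 1) ^ m := by
  classical
  have h := Finset.card_le_card_of_injOn (s := Q.support)
    (t := Fintype.piFinset fun _ : Fin m => Finset.range (t + 1))
    (fun e : (Fin m →₀ ℕ) => (⇑e : Fin m → ℕ)) (fun e he => by
      rw [Finset.mem_coe, Fintype.mem_piFinset]
      exact fun i => Finset.mem_range.2 (Nat.lt_succ_of_le (hbox e he i)))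
    (fun e₁ _ e₂ _ h => DFunLike.coe_injective h)
  rwa [Fintype.card_piFinset_const, Finset.card_range] at h

/-- Every coefficient of `Q` is bounded by the naive height `H(Q)`. -/
theorem norm_coeff_le_mvNatHeight {m : ℕ} (Q : MvPolynomial (Fin m) ℤ) {e : Fin m →₀ ℕ}
    (he : e ∈ Q.support) : ‖algebraMap ℤ ℂ (Q.coeff e)‖ ≤ (mvNatHeight Q : ℝ) := by
  have h1 : (Q.coeff e).natAbs ≤ mvNatHeight Q := by
    unfold mvNatHeight
    exact Finset.le_sup (f := fun e => (Q.coeff e).natAbs) he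
  rw [algebraMap_int_eq, eq_intCast, Complex.norm_intCast, ← Int.cast_abs, ← Nat.cast_natAbs]
  exact_mod_cast h1

/-- `|x^k − y^k| ≤ k R^k |x − y|` for `|x|, |y| ≤ R`, `R ≥ 1`. -/
theorem norm_pow_sub_pow_le_of_norm_le (x y : ℂ) (R : ℝ) (hR : 1 ≤ R) (hx : ‖x‖ ≤ R) (hy : ‖y‖ ≤ R)
    (k : ℕ) : ‖x ^ k - y ^ k‖ ≤ k * R ^ k * ‖x - y‖ := by
  induction k with
  | zero => simp
  | succ k ih =>
    have e : x ^ (k + 1) - y ^ (k + 1) = x * (x ^ k - y ^ k) + (x - y) * y ^ k := by ring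
    rw [e]
    have h0 : 0 ≤ ‖x - y‖ := norm_nonneg _
    have hR0 : 0 ≤ R := by linarith
    calc ‖x * (x ^ k - y ^ k) + (x - y) * y ^ k‖
        ≤ ‖x‖ * ‖x ^ k - y ^ k‖ + ‖x - y‖ * ‖y‖ ^ k := by
          refine (norm_add_le _ _).trans ?_
          rw [norm_mul, norm_mul, norm_pow]
      _ ≤ R * (k * R ^ k * ‖x - y‖) + ‖x - y‖ * R ^ k := by gcongr
      _ ≤ ((k + 1 : ℕ) : ℝ) * R ^ (k + 1) * ‖x - y‖ := by
          have hRk : R ^ k ≤ R ^ (k + 1) := pow_le_pow_right₀ hR (Nat.le_succ k)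
          have := mul_le_mul_of_nonneg_right hRk h0
          push_cast
          rw [pow_succ] at this ⊢
          nlinarith

/-- Products are Lipschitz in the sup norm: if `|xᵢ|, |yᵢ| ≤ R^{nᵢ}` and `|xᵢ − yᵢ| ≤ nᵢ R^{nᵢ} ε`
(`R ≥ 1`, `ε ≥ 0`) then `|∏ xᵢ − ∏ yᵢ| ≤ (Σ nᵢ) R^{Σ nᵢ} ε`. -/
theorem norm_prod_sub_prod_le {ι : Type*} (s : Finset ι) (x y : ι → ℂ) (n : ι → ℕ) (R ε : ℝ)
    (hR : 1 ≤ R) (hε : 0 ≤ ε) (hx : ∀ i ∈ s, ‖x i‖ ≤ R ^ n i) (hy : ∀ i ∈ s, ‖y i‖ ≤ R ^ n i)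
    (hxy : ∀ i ∈ s, ‖x i - y i‖ ≤ n i * R ^ n i * ε) :
    ‖∏ i ∈ s, x i - ∏ i ∈ s, y i‖ ≤ ((∑ i ∈ s, n i : ℕ) : ℝ) * R ^ (∑ i ∈ s, n i) * ε := by
  classical
  induction s using Finset.induction_on with
  | empty => simp
  | insert j s hj ih =>
    rw [Finset.prod_insert hj, Finset.prod_insert hj, Finset.sum_insert hj]
    have hx' := fun i hi => hx i (Finset.mem_insert_of_mem hi)
    have hy' := fun i hi => hy i (Finset.mem_insert_of_mem hi)
    have hxy' := fun i hi => hxy i (Finset.mem_insert_of_mem hi)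
    have hY : ‖∏ i ∈ s, y i‖ ≤ R ^ (∑ i ∈ s, n i) := by
      calc ‖∏ i ∈ s, y i‖ ≤ ∏ i ∈ s, ‖y i‖ := Finset.norm_prod_le _ _
        _ ≤ ∏ i ∈ s, R ^ n i := Finset.prod_le_prod (fun i _ => norm_nonneg _) hy'
        _ = R ^ (∑ i ∈ s, n i) := Finset.prod_pow_eq_pow_sum _ _ _
    have hR0 : 0 ≤ R := by linarith
    calc ‖x j * ∏ i ∈ s, x i - y j * ∏ i ∈ s, y i‖
        = ‖x j * (∏ i ∈ s, x i - ∏ i ∈ s, y i) + (x j - y j) * ∏ i ∈ s, y i‖ := by ring_nf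
      _ ≤ ‖x j‖ * ‖∏ i ∈ s, x i - ∏ i ∈ s, y i‖ + ‖x j - y j‖ * ‖∏ i ∈ s, y i‖ := by
          refine (norm_add_le _ _).trans ?_
          rw [norm_mul, norm_mul]
      _ ≤ R ^ n j * (((∑ i ∈ s, n i : ℕ) : ℝ) * R ^ (∑ i ∈ s, n i) * ε) +
            (n j * R ^ n j * ε) * R ^ (∑ i ∈ s, n i) := by
          gcongr
          · exact hx j (Finset.mem_insert_self j s)
          · exact ih hx' hy' hxy'
          · exact hxy j (Finset.mem_insert_self j s)
      _ = ((n j + ∑ i ∈ s, n i : ℕ) : ℝ) * R ^ (n j + ∑ i ∈ s, n i) * ε := by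
          push_cast
          rw [pow_add]
          ring

/-- MEAN VALUE BOUND for a monomial: `|a^e − b^e| ≤ |e| R^{|e|} ‖a − b‖` when all `|aᵢ|, |bᵢ| ≤ R`,
`R ≥ 1` (sup norm on `ℂᵐ`). -/
theorem norm_monomial_sub_monomial_le {m : ℕ} (a b : Fin m → ℂ) (R : ℝ) (hR : 1 ≤ R)
    (ha : ∀ i, ‖a i‖ ≤ R) (hb : ∀ i, ‖b i‖ ≤ R) (e : Fin m →₀ ℕ) :
    ‖∏ i, a i ^ e i - ∏ i, b i ^ e i‖ ≤ ((∑ i, e i : ℕ) : ℝ) * R ^ (∑ i, e i) * ‖a - b‖ :=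
  norm_prod_sub_prod_le Finset.univ (fun i => a i ^ e i) (fun i => b i ^ e i) e R ‖a - b‖ hR
    (norm_nonneg _)
    (fun i _ => by rw [norm_pow]; exact pow_le_pow_left₀ (norm_nonneg _) (ha i) _)
    (fun i _ => by rw [norm_pow]; exact pow_le_pow_left₀ (norm_nonneg _) (hb i) _)
    (fun i _ => (norm_pow_sub_pow_le_of_norm_le (a i) (b i) R hR (ha i) (hb i) (e i)).trans (by
      have := norm_le_pi_norm (a - b) i
      rw [Pi.sub_apply] at this
      have hR0 : 0 ≤ R := by linarith
      gcongr))

/-- MEAN VALUE BOUND for a polynomial on the box `[0,t]^m`: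
`|Q(a) − Q(b)| ≤ N · H(Q) · (m t) · R^{m t} · ‖a − b‖` (`N` = number of monomials). -/
theorem norm_aeval_sub_aeval_le {m t : ℕ} (Q : MvPolynomial (Fin m) ℤ)
    (hbox : ∀ e ∈ Q.support, ∀ i, e i ≤ t) (a b : Fin m → ℂ) (R : ℝ) (hR : 1 ≤ R)
    (ha : ∀ i, ‖a i‖ ≤ R) (hb : ∀ i, ‖b i‖ ≤ R) :
    ‖MvPolynomial.aeval a Q - MvPolynomial.aeval b Q‖ ≤
      Q.support.card * ((mvNatHeight Q : ℝ) * (((m * t : ℕ) : ℝ) * R ^ (m * t) * ‖a - b‖)) := by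
  rw [MvPolynomial.aeval_def, MvPolynomial.eval₂_eq', MvPolynomial.aeval_def, MvPolynomial.eval₂_eq',
    ← Finset.sum_sub_distrib]
  calc ‖∑ e ∈ Q.support, (algebraMap ℤ ℂ (Q.coeff e) * ∏ i, a i ^ e i -
          algebraMap ℤ ℂ (Q.coeff e) * ∏ i, b i ^ e i)‖
      ≤ ∑ e ∈ Q.support, ‖algebraMap ℤ ℂ (Q.coeff e) * ∏ i, a i ^ e i -
          algebraMap ℤ ℂ (Q.coeff e) * ∏ i, b i ^ e i‖ := norm_sum_le _ _
    _ ≤ ∑ _e ∈ Q.support, (mvNatHeight Q : ℝ) * (((m * t : ℕ) : ℝ) * R ^ (m * t) * ‖a - b‖) := by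
        refine Finset.sum_le_sum fun e he => ?_
        rw [← mul_sub, norm_mul]
        have hsum : ∑ i, e i ≤ m * t :=
          calc ∑ i, e i ≤ ∑ _i : Fin m, t := Finset.sum_le_sum fun i _ => hbox e he i
            _ = m * t := by simp
        refine mul_le_mul (norm_coeff_le_mvNatHeight Q he)
          ((norm_monomial_sub_monomial_le a b R hR ha hb e).trans ?_) (norm_nonneg _) (Nat.cast_nonneg _)
        have h0 : 0 ≤ ‖a - b‖ := norm_nonneg _
        have hR0 : 0 ≤ R := by linarith
        have hsum' : ((∑ i, e i : ℕ) : ℝ) ≤ ((m * t : ℕ) : ℝ) := by exact_mod_cast hsum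
        have hpow : R ^ (∑ i, e i) ≤ R ^ (m * t) := pow_le_pow_right₀ hR hsum
        gcongr
    _ = Q.support.card * _ := by rw [Finset.sum_const, nsmul_eq_mul]

end TransferOfSiegel

/-! ## The registered sub-goal of this file -/

/-- REGISTERED SUB-GOAL `stub_transferOfSiegel_lemmas` of stub `stub_transferOfSiegel` (crux
stmt-Schanuel-6116; this helper file's deliverable, in the registered `∀`-chain shape): (1) the HEIGHT OF A
SLOT `h(z) ≤ (log H + d)/d'` for `z ∈ F` of degree `≥ d'` over `ℚ`, root of a non-zero integer polynomial
of degree `≤ d` and naive height `≤ H`; (2) for an integer polynomial `Q` on the box `[0,t]^m`: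
`deg Q ≤ m t`, `#supp Q ≤ (t+1)^m`, and the MEAN VALUE BOUND
`|Q(a) − Q(b)| ≤ #supp Q · H(Q) · m t · R^{m t} · ‖a − b‖` (`‖aᵢ‖, ‖bᵢ‖ ≤ R`, `R ≥ 1`). -/
theorem stub_transferOfSiegel_lemmas :
    (∀ (F : IntermediateField ℚ ℂ) [FiniteDimensional ℚ F] (z : ℂ), z ∈ F → ∀ (d d' H : ℕ), 1 ≤ d' →
      d' ≤ (minpoly ℚ z).natDegree → ∀ (P : Polynomial ℤ), P ≠ 0 → P.natDegree ≤ d →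
      (∀ k, |P.coeff k| ≤ (H : ℤ)) → Polynomial.aeval z P = 0 →
      Literature.NumberTheory.Transcendental.weilHeight₁ F (fun _ : Unit => z) ≤ (Real.log H + d) / d') ∧
    (∀ (m t : ℕ) (Q : MvPolynomial (Fin m) ℤ), (∀ e ∈ Q.support, ∀ i, e i ≤ t) →
      Q.totalDegree ≤ m * t ∧ Q.support.card ≤ (t + 1) ^ m ∧
      ∀ (a b : Fin m → ℂ) (R : ℝ), 1 ≤ R → (∀ i, ‖a i‖ ≤ R) → (∀ i, ‖b i‖ ≤ R) →
        ‖MvPolynomial.aeval a Q - MvPolynomial.aeval b Q‖ ≤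
          Q.support.card * ((mvNatHeight Q : ℝ) * (((m * t : ℕ) : ℝ) * R ^ (m * t) * ‖a - b‖))) :=
  ⟨fun F _ _ hzF d d' H hd' hmin P hP0 hPdeg hPH hPz =>
    TransferOfSiegel.weilHeight₁_slot_le F hzF d d' H hd' hmin P hP0 hPdeg hPH hPz,
  fun _ _ Q hbox => ⟨TransferOfSiegel.totalDegree_le_of_box Q hbox,
    TransferOfSiegel.card_support_le_of_box Q hbox, fun a b R hR ha hb =>
      TransferOfSiegel.norm_aeval_sub_aeval_le Q hbox a b R hR ha hb⟩⟩

end Summit.Schanuel.Schanuel.Cruxes.KhovanskiiApproxType.LwSmallHeight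

end
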